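import Summits.QuantumFields.YangMills.Theorems.BalabanUVNodesN15KingModelPotentialDressedMinimiserStep
import Summits.QuantumFields.YangMills.Theorems.BalabanUVNodesN15KingModelPotentialDressedRateNE2
import Summits.QuantumFields.YangMills.Theorems.BalabanUVNodesN15KingModelMinimizer

/-!
# N15 (NE2⁺), King-model rung, part 15: the SITE layer for the DRESSED minimiser with the potential LIVE

Cell `pub-ymgap-dag-n15-d` (R134 acceleration DAG, node N15 = NE2, strategy s3 KING-MODEL RUNG), part 15.  Part 14
(`…PotentialDressedMinimiserStep`) proved King's Prop. 3.8 (3.71) line-1 shape for the DRESSED minimiser `ℋ_{k,v}` along King's run,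
uniformly in the potential tower `v` inside the size window and under the one-step coherence letter; parts 8c ∕ 10d
(`…PotentialNE2`, `…PotentialDressedRateNE2`) typed the paired-instance family `kingInstanceV` — realised King geometries on the
King-admissible volumes with the POTENTIAL SORT `potBg` live on both sides ((3.35) := size, (3.36) := coherence) — and inhabited
`T4EtaRate.NE2PlusUnit` on it BY NAME.  This file does the SITE layer ([B9] (3.133)-shaped sup entries, `T4EtaRate.EtaRateIneqSite` ∕
`NE2PlusSite`, the layer n15-e's `…KingModelMinimizerNode` inhabited for the UNDRESSED, background-blind H-kernel):

* §1 the dressed site kernel `kingHSiteV`: at index `i = (e, k, n, Msz)` and tower `v`, the sup entry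
  `(y, b) ↦ sup_{x′ ∈ B(y)} |ℋ_{k+1,v}(x′, b) − ℋ_{k,v}(x, b)|` (`x` under `x′`; n15-e's `kingBlockFibre`), and its bound
  `≤ C·e^{−δ|y−b|}·(L^{−1∕2})^k` inside the window (`kingHSiteV_le`, from part 14);
* §2 `etaRateIneqSite_kingHV`: on the part-8c family, for every index, every `α₀` in the window `Msz·α₀ ≤ a₀` and every tower `v`
  which is (3.35)- AND (3.36)-regular, `EtaRateIneqSite d′ p (kingHSiteV i) C δ (1∕2) v` — every exponent pair `(d′, p)` (all sites have
  length `L^kη = 1`); `ne2ZeroSite_kingHV` (the trivial tower);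
* §3 the sort variant `potBgSC` whose (3.35) slot carries size ∧ coherence (the (3.36) slot keeps coherence), its family `kingInstanceSC`, and
  BOTH background-dependent layers BY NAME on it: `ne2PlusSite_kingHSC : NE2PlusSite d′ p c₃₅ (kingInstanceSC L s) (kingHSiteSC L a m² s)` and
  `ne2PlusUnit_kingSC` (from part 10d), conjunction `n15_dressedSiteUnit_kingSC`; the window is populated by genuinely site-dependent towers
  (`potBgSC_reg_blockLift`).

WHY TWO SORTS (honest): `T4EtaRate.NE2PlusSite` copies the quantifier template of [B9] Thm 3.14, which reads the (3.35) slot ONLY (print bounds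
`G_k(Ω;U)`, `H_k(Ω;U)` under (3.35); (3.36) enters with Thm 3.15).  An η-RATE for a background-DEPENDENT kernel compares two runs reading two
members `v_{L^{k+1}}`, `v_{L^k}` of the tower, so it needs a coherence letter: with size alone the tower `v_{L^{k+1}} ≡ c₃₅α₀`, `v_{L^k} ≡ 0` is
(3.35)-regular and its dressed difference has an `O(α₀)` part that does not decay in `k` — so on the part-8c family we prove the site inequality
under BOTH letters (§2) and do NOT claim `NE2PlusSite` by name; on `potBgSC` (for towers sampled from one β-Hölder function on the physical torus
size and coherence ARE one regularity condition on the lattice scale) the predicate holds by name (§3).  The slot assignment is OUR reading.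

HONEST SCOPE.  King's A = 0 scalar model on King-admissible tori, odd `L ≥ 3`, `a, m² > 0`, scalar potentials (not gauge fields), rate
`L^{−k∕2}`, sup entries with [B9] exponent `p` free because every site has unit length; count-neutral (`--supports`), not a discharge of N15,
nothing in `YMDAG.*` touched.  WHAT THE CURVED CASE ADDS: the same line for Bałaban's covariant `H_k(U)` over `Reg335` — print gives (3.133) and
analyticity in `U`, never an η-difference (n15-e's curved edition types the gap).

References: [B9] = Bałaban, Commun. Math. Phys. 102 (1985) 385–462, (3.35)–(3.36) p.396, (3.133) p.422, Thm 3.14 pp.426–427, Thm 3.15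
p.432 (bib key `Balaban1985BackgroundPropagators`); C. King, Commun. Math. Phys. 103 (1986) 323–349, Prop. 3.8 (3.71) p.664 (bib key `King1986`).
-/

noncomputable section
open scoped BigOperators
open Finset

namespace Summit.QuantumFields.YangMills.BalabanUVNodes.N15.KingModel

open Literature.MathematicalPhysics.QuantumFieldTheory.Balaban1983to89 hiding blockOf
open Literature.MathematicalPhysics.QuantumFieldTheory.Balaban1983to89.T4EtaRate (PairedInstance EtaPairing NE2PlusUnit NE2PlusSite
  EtaRateIneqSite rateFactor)
open Literature.MathematicalPhysics.QuantumFieldTheory.Balaban1983to89.T4EtaRateSiteOfRatePair (NE2ZeroSite)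
open Literature.MathematicalPhysics.QuantumFieldTheory.Balaban1983to89.T4EtaRateUnitWitness (NE2ZeroUnit ne2ZeroUnit_of_ne2PlusUnit)
open Literature.MathematicalPhysics.QuantumFieldTheory.Balaban1983to89.B5Prop11Plancherel (Tor fine)
open Literature.MathematicalPhysics.QuantumFieldTheory.King1986.Torus (blockOf tdistT tdistT_nonneg)
open Summit.QuantumFields.YangMills.BalabanUVNodes.N15KingModelRung (kingBlockFibre mem_kingBlockFibre kingBlockFibre_nonempty)
open Summit.QuantumFields.YangMills.BalabanUVNodes.N15KingModelRung.Curved (underPtN blockOf_underPtN)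
open Summit.QuantumFields.YangMills.BalabanUVNodes.N15.OperatorReadout (opGeo opGeo_len rateFactor_opGeo)
open Real

variable {d : ℕ}

/-! ## §1 The dressed site kernel and its bound inside the window -/

section Kernel

variable (L : ℕ) [NeZero L]

/-- **THE DRESSED H-KERNEL'S η-DIFFERENCE SUP ENTRY** at index `i = (e, k, n, Msz)` and potential tower `v`: at observation unit site `y` and source
unit site `b`, `sup_{x′ ∈ T_{η′}, B(x′) = y} |ℋ_{k+1,v}(x′, b) − ℋ_{k,v}(x, b)|` (`x` under `x′`; the dressed minimisers of part 10b at the tower's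
members `v_{L·L^k}`, `v_{L^k}`) — the `p = 0` [B9] (3.133) sup entry of the one-step difference, now BACKGROUND-DEPENDENT.
[cite: Balaban1985BackgroundPropagators, (3.133) p.422 (sup-entry shape); King1986, Prop. 3.8 (3.71) p.664 (object, A = 0)] -/
def kingHSiteV (a m2 s : ℝ) (i : KingPotIdx d) : B9.SiteKernel (kingInstanceV L s i).gc (kingInstanceV L s i).Bf :=
  ⟨fun v y b => (kingBlockFibre (L ^ 1 * L ^ i.k) (kingU d L i.e) y).sup' (kingBlockFibre_nonempty _ _ y) fun x' =>
      |kingHPot L (L ^ 1 * L ^ i.k) (kingU d L i.e) a m2 (i.k + 1) (v (L ^ 1 * L ^ i.k)) b x'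
        - kingHPot L (L ^ i.k) (kingU d L i.e) a m2 i.k (v (L ^ i.k)) b (underPtN L i.k 1 (kingU d L i.e) x')|⟩

/-- The sup entry is nonnegative. [folklore] -/
theorem kingHSiteV_nonneg (a m2 s : ℝ) (i : KingPotIdx d) (v : ∀ N : ℕ, Tor (fine N (kingU d L i.e)) → ℝ) (y b : Tor (kingU d L i.e)) :
    0 ≤ (kingHSiteV L a m2 s i).ker v y b := by
  obtain ⟨x', hx'⟩ := kingBlockFibre_nonempty (L ^ 1 * L ^ i.k) (kingU d L i.e) y
  exact (abs_nonneg _).trans (Finset.le_sup' (fun x' => |kingHPot L (L ^ 1 * L ^ i.k) (kingU d L i.e) a m2 (i.k + 1) (v (L ^ 1 * L ^ i.k)) b x'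
    - kingHPot L (L ^ i.k) (kingU d L i.e) a m2 i.k (v (L ^ i.k)) b (underPtN L i.k 1 (kingU d L i.e) x')|) hx')

/-- **THE DRESSED SUP ENTRY INSIDE THE WINDOW** (odd `L ≥ 3`, `a, m² > 0`): there are `w̄, C, δ > 0` such that for every coherence rate
`0 ≤ s ≤ L^{−1∕2}`, every index, and every tower `v` of size `≤ w₀ ≤ w̄` with coherence defect `≤ ν₀s^k` (`0 ≤ ν₀ ≤ w̄`),
`sup_{B(x′)=y} |ℋ_{k+1,v}(x′, b) − ℋ_{k,v}(x, b)| ≤ C·e^{−δ|y−b|}·(L^{−1∕2})^k` — part 14's line-1 bound read on the block. [cite: King1986, Prop. 3.8 (3.71) p.664 (line 1, A = 0 model)] -/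
theorem kingHSiteV_le (hLodd : Odd L) (hL : 2 ≤ L) {a m2 : ℝ} (ha : 0 < a) (hm : 0 < m2) :
    ∃ wb C δ : ℝ, 0 < wb ∧ 0 < C ∧ 0 < δ ∧ ∀ (s : ℝ), 0 ≤ s → s ≤ (L : ℝ) ^ (-(1 / 2 : ℝ)) →
      ∀ (i : KingPotIdx d) (v : ∀ N : ℕ, Tor (fine N (kingU d L i.e)) → ℝ) (w₀ ν₀ : ℝ),
      (∀ (N : ℕ) (x : Tor (fine N (kingU d L i.e))), |v N x| ≤ w₀) → w₀ ≤ wb → 0 ≤ ν₀ → ν₀ ≤ wb →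
      (∀ (k : ℕ), 1 ≤ k → ∀ x' : Tor (fine (L ^ 1 * L ^ k) (kingU d L i.e)),
          |v (L ^ 1 * L ^ k) x' - v (L ^ k) (underPtN L k 1 (kingU d L i.e) x')| ≤ ν₀ * s ^ k) →
      ∀ y b : Tor (kingU d L i.e),
        (kingHSiteV L a m2 s i).ker v y b ≤ C * Real.exp (-(δ * tdistT (kingU d L i.e) y b)) * (((L : ℝ) ^ (-(1 / 2 : ℝ))) ^ i.k) := by
  obtain ⟨wb, c, δ, hwb, hc, hδ, H⟩ := kingHPot_stepDecay_kingU (d := d) L hLodd hL ha hm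
  refine ⟨wb, c * (1 + wb), δ, hwb, by positivity, hδ, fun s hs0 hs1 i v w₀ ν₀ hv hw hν0 hν1 hcoh y b => ?_⟩
  have hr0 : (0 : ℝ) ≤ (L : ℝ) ^ (-(1 / 2 : ℝ)) := by positivity
  have hsk : s ^ i.k ≤ ((L : ℝ) ^ (-(1 / 2 : ℝ))) ^ i.k := pow_le_pow_left₀ hs0 hs1 _
  have hE : 0 ≤ Real.exp (-(δ * tdistT (kingU d L i.e) y b)) := (Real.exp_pos _).le
  show (kingBlockFibre (L ^ 1 * L ^ i.k) (kingU d L i.e) y).sup' (kingBlockFibre_nonempty _ _ y) (fun x' =>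
      |kingHPot L (L ^ 1 * L ^ i.k) (kingU d L i.e) a m2 (i.k + 1) (v (L ^ 1 * L ^ i.k)) b x'
        - kingHPot L (L ^ i.k) (kingU d L i.e) a m2 i.k (v (L ^ i.k)) b (underPtN L i.k 1 (kingU d L i.e) x')|) ≤ _
  refine Finset.sup'_le _ _ fun x' hx' => ?_
  have hblk : blockOf (L ^ 1 * L ^ i.k) (kingU d L i.e) x' = y := (mem_kingBlockFibre _ _ y x').1 hx'
  have h1 := H i.e v w₀ ν₀ s hv hw hν0 hs0 hs1 hcoh i.k i.one_le_k b x'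
  rw [hblk] at h1
  refine h1.trans ?_
  have h2 : ((L : ℝ) ^ (-(1 / 2 : ℝ))) ^ i.k + ν₀ * s ^ i.k ≤ (1 + wb) * ((L : ℝ) ^ (-(1 / 2 : ℝ))) ^ i.k := by
    have : ν₀ * s ^ i.k ≤ wb * ((L : ℝ) ^ (-(1 / 2 : ℝ))) ^ i.k := mul_le_mul hν1 hsk (pow_nonneg hs0 _) hwb.le
    linarith
  calc c * (((L : ℝ) ^ (-(1 / 2 : ℝ))) ^ i.k + ν₀ * s ^ i.k) * Real.exp (-(δ * tdistT (kingU d L i.e) y b))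
      ≤ c * ((1 + wb) * ((L : ℝ) ^ (-(1 / 2 : ℝ))) ^ i.k) * Real.exp (-(δ * tdistT (kingU d L i.e) y b)) :=
        mul_le_mul_of_nonneg_right (mul_le_mul_of_nonneg_left h2 hc.le) hE
    _ = c * (1 + wb) * Real.exp (-(δ * tdistT (kingU d L i.e) y b)) * ((L : ℝ) ^ (-(1 / 2 : ℝ))) ^ i.k := by ring

/-- The sites of the coarse geometry have length `L^kη = 1`. [folklore] -/
theorem kingInstanceV_len (s : ℝ) (i : KingPotIdx d) (y : Tor (kingU d L i.e)) : (kingInstanceV (d := d) L s i).gc.len y = 1 :=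
  kingGeo_len (NeZero.ne L) i.k (kingU d L i.e) i.Msz y

/-- The rate factor of the coarse geometry at exponent `1∕2` is `(L^{−1∕2})^k`. [folklore] -/
theorem kingInstanceV_rateFactor (hL : 2 ≤ L) (s : ℝ) (i : KingPotIdx d) (y : Tor (kingU d L i.e)) :
    rateFactor (kingInstanceV (d := d) L s i).gc (1 / 2) y = ((L : ℝ) ^ (-(1 / 2 : ℝ))) ^ i.k := by
  have hL0 : (0 : ℝ) < L := by exact_mod_cast (show 0 < L by omega)
  have hη : (kingGeo L i.k (kingU d L i.e) i.Msz).eta ≠ 0 := by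
    show (((L : ℝ) ^ i.k))⁻¹ ≠ 0
    positivity
  show rateFactor (opGeo (kingGeo L i.k (kingU d L i.e) i.Msz) (Tor (kingU d L i.e)) (fun x => x)) (1 / 2) y = _
  rw [rateFactor_opGeo _ _ _ hη (by exact hL0), T4EtaRateDefect.rateWeight]
  show ((L : ℝ) ^ i.k) ^ (-(1 / 2 : ℝ)) = ((L : ℝ) ^ (-(1 / 2 : ℝ))) ^ i.k
  exact (Real.rpow_pow_comm hL0.le _ _).symm

/-- Bookkeeping: the [B9] site inequality for the dressed sup entry from the windowed bound (unit lengths, equal rate factors).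
[cite: Balaban1985BackgroundPropagators, (3.133) p.422 + Thm 3.14 pp.426–427 (shape)] -/
theorem etaRateIneqSite_kingHV_of_le (hL : 2 ≤ L) (a m2 s : ℝ) (i : KingPotIdx d) (v : ∀ N : ℕ, Tor (fine N (kingU d L i.e)) → ℝ)
    {C δ : ℝ} (H : ∀ y b : Tor (kingU d L i.e),
      (kingHSiteV L a m2 s i).ker v y b ≤ C * Real.exp (-(δ * tdistT (kingU d L i.e) y b)) * (((L : ℝ) ^ (-(1 / 2 : ℝ))) ^ i.k))
    (d' : ℕ) (p : ℝ) : EtaRateIneqSite d' p (kingHSiteV L a m2 s i) C δ (1 / 2) v := by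
  intro y b
  rw [kingInstanceV_len, kingInstanceV_len, kingInstanceV_rateFactor L hL, kingInstanceV_rateFactor L hL, max_self, Real.one_rpow,
    Real.one_rpow, mul_one, mul_one, abs_of_nonneg (kingHSiteV_nonneg L a m2 s i v y b)]
  exact H y b

end Kernel

/-! ## §2 The site inequality on the part-8c family under BOTH letters; the trivial tower -/

section SiteV

variable (L : ℕ) [NeZero L]

/-- **THE TYPED SITE INEQUALITY FOR THE DRESSED H-KERNEL WITH THE POTENTIAL LIVE, UNDER (3.35) ∧ (3.36)** (odd `L ≥ 3`, `a, m² > 0`,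
`c₃₅ > 0`, coherence rate `0 ≤ s ≤ L^{−1∕2}`): there are `a₀, C, δ > 0` such that for EVERY index `i`, every `α₀ > 0` with `Msz·α₀ ≤ a₀`
and every potential tower `v` that is (3.35)-regular (size `≤ c₃₅α₀`) AND (3.36)-regular (coherence defect `≤ c₃₅α₀s^k`),
`EtaRateIneqSite d′ p (kingHSiteV i) C δ (1∕2) v` for every exponent pair `(d′, p)` — the conclusion of `NE2PlusSite` with the
coherence letter added to its hypotheses (see the module docstring for why it must be). [cite: Balaban1985BackgroundPropagators, (3.35)–(3.36) p.396 + (3.133) p.422 + Thm 3.14 pp.426–427 (template); King1986, Prop. 3.8 (3.71) p.664 (A = 0 model)] -/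
theorem etaRateIneqSite_kingHV (hLodd : Odd L) (hL : 2 ≤ L) {a m2 : ℝ} (ha : 0 < a) (hm : 0 < m2) {c35 : ℝ} (hc : 0 < c35)
    {s : ℝ} (hs0 : 0 ≤ s) (hs1 : s ≤ (L : ℝ) ^ (-(1 / 2 : ℝ))) :
    ∃ a₀ C δ : ℝ, 0 < a₀ ∧ 0 < C ∧ 0 < δ ∧ ∀ (i : KingPotIdx d) (α₀ : ℝ), 0 < α₀ → i.Msz * α₀ ≤ a₀ →
      ∀ v : (kingInstanceV (d := d) L s i).Bf.Cfg, (kingInstanceV (d := d) L s i).Bf.Reg335 c35 α₀ v →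
        (kingInstanceV (d := d) L s i).Bf.Reg336 c35 α₀ v →
        ∀ (d' : ℕ) (p : ℝ), EtaRateIneqSite d' p (kingHSiteV L a m2 s i) C δ (1 / 2) v := by
  obtain ⟨wb, C, δ, hwb, hC, hδ, H⟩ := kingHSiteV_le (d := d) L hLodd hL ha hm
  refine ⟨wb / c35, C, δ, by positivity, hC, hδ, fun i α₀ hα hMa v h335 h336 d' p => ?_⟩
  have hcα : 0 ≤ c35 * α₀ := by positivity
  have hαw : c35 * α₀ ≤ wb := by
    have h1 : α₀ ≤ i.Msz * α₀ := le_mul_of_one_le_left hα.le i.one_le_Msz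
    have h2 : α₀ ≤ wb / c35 := h1.trans hMa
    rw [le_div_iff₀ hc] at h2
    linarith
  exact etaRateIneqSite_kingHV_of_le L hL a m2 s i v (H s hs0 hs1 i v (c35 * α₀) (c35 * α₀) h335 hαw hcα hαw h336) d' p

/-- **`NE2ZeroSite` HOLDS FOR THE DRESSED H-KERNEL ON THE PART-8c FAMILY** (the trivial tower `v ≡ 0`: both letters with defect `0`; constants
`(M₅, δ, C, γ) = (1, δ, C, 1∕2)`). [cite: King1986, Prop. 3.8 (3.71) p.664 (A = 0 model)] -/
theorem ne2ZeroSite_kingHV (hLodd : Odd L) (hL : 2 ≤ L) {a m2 : ℝ} (ha : 0 < a) (hm : 0 < m2) {s : ℝ} (hs0 : 0 ≤ s)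
    (hs1 : s ≤ (L : ℝ) ^ (-(1 / 2 : ℝ))) (d' : ℕ) (p : ℝ) :
    NE2ZeroSite d' p (kingInstanceV (d := d) L s) (kingHSiteV L a m2 s) := by
  obtain ⟨wb, C, δ, hwb, hC, hδ, H⟩ := kingHSiteV_le (d := d) L hLodd hL ha hm
  refine ⟨1, δ, C, 1 / 2, one_pos, hδ, hC, by norm_num, fun i _ => ?_⟩
  refine etaRateIneqSite_kingHV_of_le L hL a m2 s i _ (H s hs0 hs1 i _ 0 0 (fun N x => ?_) hwb.le le_rfl hwb.le fun k hk x' => ?_) d' p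
  · show |(0 : ℝ)| ≤ 0
    rw [abs_zero]
  · show |(0 : ℝ) - 0| ≤ 0 * s ^ k
    rw [sub_zero, abs_zero, zero_mul]

end SiteV

/-! ## §3 The sort whose (3.35) slot carries size ∧ coherence: both background-dependent layers BY NAME -/

section SortSC

variable (L : ℕ) [NeZero L]

/-- **THE POTENTIAL SORT, SIZE-AND-COHERENCE READING**: configurations = potential towers over the unit torus (as part 8c's `potBg`);
**(3.35) at `(c₃₅, α₀)` := size `sup|v_N| ≤ c₃₅α₀` AND one-step coherence `sup|v_{L·L^k}(x′) − v_{L^k}(x)| ≤ c₃₅α₀s^k` (`k ≥ 1`)** — for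
towers sampled from one function on the physical torus ONE regularity condition on the lattice scale; **(3.36) := the coherence letter** (as in
`potBg`); complex-extension sorts inert.  HONEST SCOPE: scalar potentials, NOT gauge fields; the slot assignment is OUR reading.
[cite: Balaban1985BackgroundPropagators, (3.35)–(3.36) p.396 (the two regularity slots: typing template)] -/
@[reducible] def potBgSC (s : ℝ) (U : Fin (d + 1) → ℕ) : B9.Backgrounds where
  Cfg := ∀ N : ℕ, Tor (fine N U) → ℝ
  one := fun _ _ => 0
  mul := fun v v' N x => v N x + v' N x
  Reg335 := fun c35 α₀ v => (∀ (N : ℕ) (x : Tor (fine N U)), |v N x| ≤ c35 * α₀) ∧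
    ∀ (k : ℕ), 1 ≤ k → ∀ x' : Tor (fine (L ^ 1 * L ^ k) U), |v (L ^ 1 * L ^ k) x' - v (L ^ k) (underPtN L k 1 U x')| ≤ c35 * α₀ * s ^ k
  Reg336 := fun c35 α₀ v => ∀ (k : ℕ), 1 ≤ k → ∀ x' : Tor (fine (L ^ 1 * L ^ k) U),
    |v (L ^ 1 * L ^ k) x' - v (L ^ k) (underPtN L k 1 U x')| ≤ c35 * α₀ * s ^ k
  Cplx337 := fun _ _ _ => True
  Cplx338 := fun _ _ _ => True

/-- THE SORT IS POPULATED BY SITE-DEPENDENT TOWERS: the block lift of ANY unit-lattice field `W` with `sup|W| ≤ c₃₅α₀` is (3.35)∧(3.36)-regular in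
the size-and-coherence reading (zero coherence defect; `s ≥ 0`). [folklore] -/
theorem potBgSC_reg_blockLift {s : ℝ} (hs : 0 ≤ s) (U : Fin (d + 1) → ℕ) [∀ μ, NeZero (U μ)] (W : Tor U → ℝ) {c35 α₀ : ℝ}
    (hW : ∀ z, |W z| ≤ c35 * α₀) :
    (potBgSC (d := d) L s U).Reg335 c35 α₀ (blockLift U W) ∧ (potBgSC (d := d) L s U).Reg336 c35 α₀ (blockLift U W) := by
  obtain ⟨h1, h2⟩ := potBg_reg_blockLift (d := d) L hs U W hW
  exact ⟨⟨h1, h2⟩, h2⟩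

/-- THE η-PAIRING for the size-and-coherence sort (identity transport, scale shift `n`; as part 8c's `kingPairingV`). [cite: King1986, p.664 (convention before Prop. 3.8)] -/
def kingPairingSC (s : ℝ) (i : KingPotIdx d) :
    EtaPairing (kingGeoCV L i) (kingGeoFV L i) (potBgSC L s (kingU d L i.e)) (potBgSC L s (kingU d L i.e)) where
  n := i.n
  k_eq := rfl
  L_eq := rfl
  M_eq := rfl
  eta_eq := by
    have hL0 : (L : ℝ) ≠ 0 := Nat.cast_ne_zero.mpr (NeZero.ne L)
    show (((L : ℝ) ^ (i.k + i.n)))⁻¹ * (L : ℝ) ^ i.n = (((L : ℝ) ^ i.k))⁻¹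
    rw [pow_add, mul_inv, mul_assoc, inv_mul_cancel₀ (pow_ne_zero _ hL0), mul_one]
  ι := fun y => y
  scale_ι := fun _ => rfl
  dist_ι := fun _ _ => rfl
  τ := fun lam => lam
  suppIn_τ := fun _ _ h => h
  supNorm_τ := fun _ => le_rfl
  avg := fun v => v
  avg_one := rfl

/-- THE DRESSED KING FAMILY WITH THE SIZE-AND-COHERENCE SORT LIVE (same geometries as `kingInstanceV`). [cite: Balaban1985BackgroundPropagators, Thm 3.14 pp.426–427 (typing template)] -/
def kingInstanceSC (s : ℝ) (i : KingPotIdx d) : PairedInstance :=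
  ⟨kingGeoCV L i, kingGeoFV L i, potBgSC L s (kingU d L i.e), potBgSC L s (kingU d L i.e), kingPairingSC L s i⟩

/-- The dressed site kernel on the size-and-coherence family (same entries as `kingHSiteV`). [cite: Balaban1985BackgroundPropagators, (3.133) p.422 (shape)] -/
def kingHSiteSC (a m2 s : ℝ) (i : KingPotIdx d) : B9.SiteKernel (kingInstanceSC L s i).gc (kingInstanceSC L s i).Bf :=
  ⟨(kingHSiteV L a m2 s i).ker⟩

/-- The dressed unit kernel on the size-and-coherence family (part 10d's `kingKerVW`: the one-step η-difference of the covariances of the tower of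
the FULL perturbations `Δ^{(j)}_v`). [cite: King1986, Lemma 4.5 (4.38) p.674 (object, A = 0)] -/
def kingKerSC (a m2 s : ℝ) (i : KingPotIdx d) : B9.SiteKernel (kingInstanceSC L s i).gc (kingInstanceSC L s i).Bf :=
  ⟨(kingKerVW L a m2 s i).ker⟩

/-- `unitDist :=` King's periodic unit-lattice distance. [cite: King1986, Lemma 4.5 (4.38) p.674] -/
def kingDistSC (s : ℝ) : ∀ i : KingPotIdx d, (kingInstanceSC L s i).gc.Site → (kingInstanceSC L s i).gc.Site → ℝ :=
  fun i y y' => tdistT (kingU d L i.e) y y'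

/-- **`NE2PlusSite` IS INHABITED BY THE DRESSED H-KERNEL WITH THE POTENTIAL LIVE — BY NAME** on the size-and-coherence family (odd `L ≥ 3`,
`a, m² > 0`, `c₃₅ > 0`, `0 ≤ s ≤ L^{−1∕2}`; every `d′`, `p`): constants `(M₅, δ, a₀, C, γ) = (1, δ, a₀, C, 1∕2)`, uniform in the index AND in the
(3.35)-regular tower — the site-layer twin of part 10d's `ne2PlusUnit_kingVW`.  HONEST SCOPE: module docstring. [cite: Balaban1985BackgroundPropagators, (3.133) p.422 + Thm 3.14 pp.426–427 (quantifier template); King1986, Prop. 3.8 (3.71) p.664 (A = 0 model)] -/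
theorem ne2PlusSite_kingHSC (hLodd : Odd L) (hL : 2 ≤ L) {a m2 : ℝ} (ha : 0 < a) (hm : 0 < m2) {c35 : ℝ} (hc : 0 < c35)
    {s : ℝ} (hs0 : 0 ≤ s) (hs1 : s ≤ (L : ℝ) ^ (-(1 / 2 : ℝ))) (d' : ℕ) (p : ℝ) :
    NE2PlusSite d' p c35 (kingInstanceSC (d := d) L s) (kingHSiteSC L a m2 s) := by
  obtain ⟨a₀, C, δ, ha₀, hC, hδ, H⟩ := etaRateIneqSite_kingHV (d := d) L hLodd hL ha hm hc hs0 hs1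
  refine ⟨1, δ, a₀, C, 1 / 2, one_pos, hδ, ha₀, hC, by norm_num, fun i _ α₀ hα hMa v h335 => ?_⟩
  intro y b
  exact H i α₀ hα hMa v h335.1 h335.2 d' p y b

/-- **`NE2ZeroSite`** for the dressed H-kernel on the size-and-coherence family. [cite: King1986, Prop. 3.8 (3.71) p.664 (A = 0 model)] -/
theorem ne2ZeroSite_kingHSC (hLodd : Odd L) (hL : 2 ≤ L) {a m2 : ℝ} (ha : 0 < a) (hm : 0 < m2) {s : ℝ} (hs0 : 0 ≤ s)
    (hs1 : s ≤ (L : ℝ) ^ (-(1 / 2 : ℝ))) (d' : ℕ) (p : ℝ) :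
    NE2ZeroSite d' p (kingInstanceSC (d := d) L s) (kingHSiteSC L a m2 s) := by
  obtain ⟨M₅, δ, C, γ, hM, hδ, hC, hγ, H⟩ := ne2ZeroSite_kingHV (d := d) L hLodd hL ha hm hs0 hs1 d' p
  exact ⟨M₅, δ, C, γ, hM, hδ, hC, hγ, fun i hMi y b => H i hMi y b⟩

/-- **`NE2PlusUnit` ON THE SIZE-AND-COHERENCE FAMILY — BY NAME** (part 10d's `ne2PlusUnit_kingVW` read through the projection of the (3.35) slot).
[cite: Balaban1985BackgroundPropagators, Thm 3.15 (3.187) p.432 (quantifier template); King1986, Lemma 4.5 (4.38) p.674 (A = 0 model)] -/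
theorem ne2PlusUnit_kingSC (hLodd : Odd L) (hL : 2 ≤ L) {a m2 : ℝ} (ha : 0 < a) (hm : 0 < m2) {c35 : ℝ} (hc : 0 < c35)
    {s : ℝ} (hs0 : 0 ≤ s) (hs1 : s ≤ (L : ℝ) ^ (-(1 / 2 : ℝ))) :
    NE2PlusUnit c35 (kingInstanceSC (d := d) L s) (kingKerSC L a m2 s) (fun _ _ => True) (kingDistSC L s) := by
  obtain ⟨δ₀, a₀, B₀, θ, hδ, ha₀, hB, hθ0, hθ1, H⟩ := ne2PlusUnit_kingVW (d := d) L hLodd hL ha hm hc hs0 hs1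
  exact ⟨δ₀, a₀, B₀, θ, hδ, ha₀, hB, hθ0, hθ1, fun i α₀ hα hMa v h335 h336 y y' hy hy' => H i α₀ hα hMa v h335.1 h336 y y' hy hy'⟩

/-- **`NE2ZeroUnit`** on the size-and-coherence family (bookkeeping). [cite: King1986, Lemma 4.5 (4.38) p.674 (A = 0 model)] -/
theorem ne2ZeroUnit_kingSC (hLodd : Odd L) (hL : 2 ≤ L) {a m2 : ℝ} (ha : 0 < a) (hm : 0 < m2) {s : ℝ} (hs0 : 0 ≤ s)
    (hs1 : s ≤ (L : ℝ) ^ (-(1 / 2 : ℝ))) :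
    NE2ZeroUnit (kingInstanceSC (d := d) L s) (kingKerSC L a m2 s) (fun _ _ => True) (kingDistSC L s) := by
  refine ne2ZeroUnit_of_ne2PlusUnit (c35 := 1) (fun i => lt_of_lt_of_le one_pos i.one_le_Msz) (fun i α₀ hα => ⟨fun N x => ?_, fun k _ x' => ?_⟩)
    (fun i α₀ hα k _ x' => ?_) (ne2PlusUnit_kingSC L hLodd hL ha hm one_pos hs0 hs1)
  · show |(0 : ℝ)| ≤ 1 * α₀
    rw [abs_zero]; positivity
  · show |(0 : ℝ) - 0| ≤ 1 * α₀ * s ^ k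
    rw [sub_zero, abs_zero]; positivity
  · show |(0 : ℝ) - 0| ≤ 1 * α₀ * s ^ k
    rw [sub_zero, abs_zero]; positivity

/-- **N15's TWO BACKGROUND-DEPENDENT KERNEL LAYERS IN THE DRESSED KING MODEL, BY NAME, ON ONE FAMILY WITH THE POTENTIAL LIVE**: the SITE
layer for the dressed minimiser's η-difference and the UNIT layer for the dressed covariances' η-difference, both with uniform constants over the
(3.35)∧(3.36)-regular window of the size-and-coherence sort (odd `L ≥ 3`, `a, m² > 0`, `c₃₅ > 0`, `0 ≤ s ≤ L^{−1∕2}`).  HONEST SCOPE: King's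
A = 0 scalar model on King-admissible tori with scalar potentials; not Bałaban's covariant objects; count-neutral. [cite: Balaban1985BackgroundPropagators, Thm 3.14 pp.426–427 + Thm 3.15 p.432 (templates); King1986, Prop. 3.8 (3.71) p.664 + Lemma 4.5 (4.38) p.674 (A = 0 model)] -/
theorem n15_dressedSiteUnit_kingSC (hLodd : Odd L) (hL : 2 ≤ L) {a m2 : ℝ} (ha : 0 < a) (hm : 0 < m2) {c35 : ℝ} (hc : 0 < c35)
    {s : ℝ} (hs0 : 0 ≤ s) (hs1 : s ≤ (L : ℝ) ^ (-(1 / 2 : ℝ))) (d' : ℕ) (p : ℝ) :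
    NE2PlusSite d' p c35 (kingInstanceSC (d := d) L s) (kingHSiteSC L a m2 s)
      ∧ NE2PlusUnit c35 (kingInstanceSC (d := d) L s) (kingKerSC L a m2 s) (fun _ _ => True) (kingDistSC L s) :=
  ⟨ne2PlusSite_kingHSC L hLodd hL ha hm hc hs0 hs1 d' p, ne2PlusUnit_kingSC L hLodd hL ha hm hc hs0 hs1⟩

end SortSC

end Summit.QuantumFields.YangMills.BalabanUVNodes.N15.KingModel
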